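import Mathlib
import Literature.Analysis.FluidPDE.Tao2016AveragedNS.ShiftSetCascadeFlows
import Literature.Analysis.FluidPDE.Tao2016AveragedNS.ShiftSetCascadeFlux
import Summits.NavierStokesRegularity.NavierStokesRegularity.Theorems.TaoLadderRungTwoFlatCertificateGlueCheckerChainOn
import Summits.NavierStokesRegularity.NavierStokesRegularity.Theorems.TaoLadderRungTwoFlatCertificateGlueCheckerAssembleBoxOn
import HarnessLib

/-!
# Certificate glue on a shift set `𝕊`, XXVIII-b: THE CHAIN CHECKER WITH BOX REGIONS — `StepCert j` of the definitional mesh from the tests of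
  record `j`, its BOX record (`lo`, `hi`, `K`, `δ`) and the hand-over to record `j+1`; plus: every hull state lies in the weighted box
  (so transit / readout hull conditions reduce to per-coordinate box tests)
  (helper for items stmt-NavierStokesRegularity-22987 `FlatGapCertificatesV2` (crux K_A♭ of route TaoLadderRungTwoFlat) and stmt-24295 K_A₂(64);
  cell harvest/h2-tao-ladder, p1 g15; theory-1 R9 «box region», bus l.534)

The node family is that of glue XXVIII (`nodeOf`); the hull family `hullOfB j` is the dense tube of step `j` MEET the per-component Picard
tube, fattened by `A j·ω` (glue XIX-g); `stepCert_of_rec_box` is glue XXVII-b `stepCert_of_checks_box` with the three inclusions discharged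
definitionally and by the hand-over `handsOver (rec j) (rec (j+1))`; `inBox_of_hullOfB` puts every hull state in the weighted box `[lo, hi]·ω`
by the box-covering test (C13).

HONEST FRAMING: Tao-type MODEL lattices (Tao 2016 §4/§6 vocabulary, shift-set parametrised); soundness of a checker — NO certificate
instance exists in the tree, nothing is certified here, no stub is closed, nothing here is a statement about the Navier–Stokes equations.
-/

-- the sub-problem namespace repeats the summit name by design (D-0017)
set_option linter.dupNamespace false

namespace Summit.NavierStokesRegularity.NavierStokesRegularity.Theorems

open Set Finset Literature.Analysis.FluidPDE Literature.Analysis.FluidPDE.TaoCascade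
open Summit.NavierStokesRegularity.NavierStokesRegularity.Theorems.TaylorModelCert
open Summit.NavierStokesRegularity.NavierStokesRegularity.Theorems.TaylorModelReadout

namespace CertificateGlueOn

/-- **ONE BOX RECORD**: the weighted box `[lo, hi]·ω` of a step, its Lipschitz constant `K` and input defect `δ`. [folklore] -/
structure BoxRec where
  /-- lower box vector (weighted coordinates) -/
  lo : Array Dyad
  /-- upper box vector (weighted coordinates) -/
  hi : Array Dyad
  /-- Lipschitz constant of the truncated field on the box -/
  K : ℚ
  /-- input defect on the box -/
  δ : Dyad

variable {m : ℕ} {Kb Ka : ℤ}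

/-- The hull family DEFINED as the time-resolved tube of step `j` meet the per-component Picard tube, fattened by `A j`. [folklore] -/
def hullOfB (Kb Ka : ℤ) (shifts : List (ℤ × ℤ × ℤ)) (q : ℚ) (αq : Fin m → Fin m → Fin m → ℤ × ℤ × ℤ → ℚ) (ωq : Fin m → ℤ → ℚ)
    (prec p : ℕ) (Sp Sm : IntervalD) (b : Dyad) (rec : ℕ → StepRec) (j : ℕ) (y : Fin m → ℤ → ℝ) : Prop :=
  ∃ u ∈ Icc (0 : ℝ) ((rec j).h : ℝ), ∃ q' : Fin m → ℤ → ℝ,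
    TubeL shifts.toFinset (q : ℝ) (fun i₁ i₂ i μ => (αq i₁ i₂ i μ : ℝ)) Kb Ka (fun i k => (ωq i k : ℝ)) p b.toReal
      (rec j).mC.toReal (rec j).ρC.toReal ((rec j).E₀ : ℝ)
      (((rec j).mC.toReal + ((rec j).ρC.toReal + ((rec j).E₀ : ℝ))) /
        (1 - b.toReal * ((rec j).mC.toReal + ((rec j).ρC.toReal + ((rec j).E₀ : ℝ))) * ((rec j).h : ℝ)))
      (dvec (n := m * winLen Kb Ka) (rec j).x) (dmat (n := m * winLen Kb Ka) (rec j).C) (dvec (n := m * winLen Kb Ka) (rec j).r)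
      u q' ∧
    PicardTube Kb Ka (fun i k => (ωq i k : ℝ)) (dvec (n := m * winLen Kb Ka) (rec j).x)
      (fun d => (bRowSum Kb Ka shifts (coefBoxOf prec αq ωq Sp Sm) (finProdFinEquiv.symm d).1
        (shellAt Kb (finProdFinEquiv.symm d).2)).toReal)
      (rec j).ρC.toReal ((rec j).E₀ : ℝ)
      (((rec j).mC.toReal + ((rec j).ρC.toReal + ((rec j).E₀ : ℝ))) /
        (1 - b.toReal * ((rec j).mC.toReal + ((rec j).ρC.toReal + ((rec j).E₀ : ℝ))) * ((rec j).h : ℝ)))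
      u q' ∧
    ∀ i k, -Kb ≤ k → k ≤ Ka → |y i k - q' i k| ≤ ((rec j).A : ℝ) * (ωq i k : ℝ)

/-- **`StepCert j` OF THE DEFINITIONAL MESH (BOX HULLS) FROM THE TESTS OF RECORD `j`, ITS BOX RECORD, AND THE HAND-OVER TO RECORD `j+1`.**
[cite: Zgliczynski2002C1Lohner, §3–4 (Lohner-type parallelepiped frames and the C¹/variational enclosure); cell certificate format, chain checker, box region] -/
theorem stepCert_of_rec_box (hKb : 0 ≤ Kb) (hKa : 1 ≤ Ka) {shifts : List (ℤ × ℤ × ℤ)} (hnd : shifts.Nodup)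
    (h𝕊 : IsNearestNeighbourSet shifts.toFinset) {q : ℚ} (hq : 0 < 1 + (q : ℝ))
    {αq : Fin m → Fin m → Fin m → ℤ × ℤ × ℤ → ℚ} {ωq : Fin m → ℤ → ℚ} (hω : ∀ i k, 0 < ωq i k)
    {prec p kexp nexp : ℕ} {Sp Sm : IntervalD} (hSp : sqrtCheck prec (1 + q) Sp = true)
    (hSm : sqrtCheck prec (1 / (1 + q)) Sm = true) {M : ℤ → ℝ} {t : ℕ → ℝ} {rec : ℕ → StepRec} {box : ℕ → BoxRec} {j : ℕ}
    {bD : Dyad} {Eb Et : ℚ}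
    (hb : 0 ≤ bD.toReal) (hmC : 0 ≤ (rec j).mC.toReal) (hρC : 0 ≤ (rec j).ρC.toReal) (hE₀ : (0 : ℚ) ≤ (rec j).E₀)
    (hAA' : (rec j).A < (rec j).A') (ht : t (j + 1) - t j = ((rec j).h : ℝ))
    (hnext : handsOver (rec j) (rec (j + 1)))
    (hchkB : checkB m Kb Ka shifts (coefBoxOf prec αq ωq Sp Sm) bD = true)
    (h2 : checkAbsLe (m * winLen Kb Ka) (rec j).x (rec j).mC = true)
    (h3 : checkRowSum (m * winLen Kb Ka) (rec j).C (rec j).r (rec j).ρC = true)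
    (h4 : checkTPoly (m * winLen Kb Ka) prec
      (IntervalD.polyLevelsA (m * winLen Kb Ka) prec
        (IntervalD.jetLevelsA (m * winLen Kb Ka) (pqBoxA Kb Ka prec shifts (coefBoxOf prec αq ωq Sp Sm)) prec
          (pointBoxA (m * winLen Kb Ka) (rec j).x) p) p (ofRatRel prec (rec j).h)) (rec j).x' (rec j).dP = true)
    (h5 : checkNVh (m * winLen Kb Ka)
      (IntervalD.polyLevelsA (m * winLen Kb Ka) prec
        (IntervalD.varJetLevelsA (m * winLen Kb Ka) (pqBoxA Kb Ka prec shifts (coefBoxOf prec αq ωq Sp Sm)) prec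
          (IntervalD.jetLevelsA (m * winLen Kb Ka) (pqBoxA Kb Ka prec shifts (coefBoxOf prec αq ωq Sp Sm)) prec
            (pointBoxA (m * winLen Kb Ka) (rec j).x) p)
          (unitBoxA (m * winLen Kb Ka)) p) p (ofRatRel prec (rec j).h)) (rec j).NVh = true)
    (h6 : checkFrame (m * winLen Kb Ka)
      (pcolsA prec (m * winLen Kb Ka) (rec j).Cin (vcolsA Kb Ka prec shifts (coefBoxOf prec αq ωq Sp Sm) p
        (IntervalD.jetLevelsA (m * winLen Kb Ka) (pqBoxA Kb Ka prec shifts (coefBoxOf prec αq ωq Sp Sm)) prec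
          (pointBoxA (m * winLen Kb Ka) (rec j).x) p) (ofRatRel prec (rec j).h) (rec j).C)) (rec j).r (rec j).r' = true)
    (h7 : checkKappa prec (m * winLen Kb Ka) (rec j).Cn
      (pcolsA prec (m * winLen Kb Ka) (rec j).Cin (vcolsA Kb Ka prec shifts (coefBoxOf prec αq ωq Sp Sm) p
        (IntervalD.jetLevelsA (m * winLen Kb Ka) (pqBoxA Kb Ka prec shifts (coefBoxOf prec αq ωq Sp Sm)) prec
          (pointBoxA (m * winLen Kb Ka) (rec j).x) p) (ofRatRel prec (rec j).h) (rec j).C))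
      (vcolsA Kb Ka prec shifts (coefBoxOf prec αq ωq Sp Sm) p
        (IntervalD.jetLevelsA (m * winLen Kb Ka) (pqBoxA Kb Ka prec shifts (coefBoxOf prec αq ωq Sp Sm)) prec
          (pointBoxA (m * winLen Kb Ka) (rec j).x) p) (ofRatRel prec (rec j).h) (rec j).C) (rec j).r (rec j).κI = true)
    (h8 : checkERec p (dyadToRat bD) (dyadToRat (rec j).mC) (dyadToRat (rec j).ρC) (rec j).E₀ (dyadToRat (rec j).κI)
      (dyadToRat (rec j).dP) (dyadToRat (rec j).NVh) (rec j).h (rec j).E₁ = true)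
    (h9 : checkGuard (dyadToRat bD) (dyadToRat (rec j).mC) (dyadToRat (rec j).ρC) (rec j).E₀ (rec j).h = true)
    (h13 : checkBoxCovers m Kb Ka shifts (coefBoxOf prec αq ωq Sp Sm) (rec j).x (box j).lo (box j).hi (dyadToRat bD)
      (dyadToRat (rec j).mC) (dyadToRat (rec j).ρC) (rec j).E₀ (rec j).h (rec j).A' = true)
    (h10 : checkLipT m Kb Ka shifts (coefBoxOf prec αq ωq Sp Sm) (box j).lo (box j).hi (box j).K = true)
    (h11 : checkDefectT m Kb Ka prec shifts αq ωq Eb Et (box j).lo (box j).hi Sp Sm (box j).δ = true)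
    (h12 : checkGronwallK (box j).K (dyadToRat (box j).δ) (rec j).h (rec j).A kexp nexp = true) :
    StepCert shifts.toFinset (q : ℝ) (fun i₁ i₂ i μ => (αq i₁ i₂ i μ : ℝ)) Kb Ka (Eb : ℝ) (Et : ℝ) M t
      (nodeOf Kb Ka ωq rec) (hullOfB Kb Ka shifts q αq ωq prec p Sp Sm bD rec) j := by
  refine stepCert_of_checks_box hKb hKa hnd h𝕊 hq hω hSp hSm hb hmC hρC hE₀ hAA' ht hchkB h2 h3 h4 h5 h6 h7 h8 h9 h13 h10 h11
    h12 (fun y hy => hy) (fun u hu y q' hq' hpic hnear => ⟨u, hu, q', hq', hpic, hnear⟩) (fun y hy => ?_)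
  -- hand-over: the landing parallelepiped of record `j` is the start node of record `j+1`
  obtain ⟨hx, hC, hr, hE⟩ := hnext
  show PInPara Kb Ka (fun i k => (ωq i k : ℝ)) (dvec (rec (j + 1)).x) (dmat (rec (j + 1)).C) (dvec (rec (j + 1)).r)
    ((rec (j + 1)).E₀ : ℝ) y
  rw [hx, hC, hr, hE]
  push_cast
  exact hy

/-- **EVERY HULL STATE LIES IN THE WEIGHTED BOX** `[lo, hi]·ω` of its step, by the box-covering test (C13) — so a transit condition
`y i k < M k` or a readout window bound on `Hull j` reduces to a per-coordinate test on `hi` / `lo`. [folklore] -/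
theorem inBox_of_hullOfB {shifts : List (ℤ × ℤ × ℤ)} (hnd : shifts.Nodup) {q : ℚ}
    {αq : Fin m → Fin m → Fin m → ℤ × ℤ × ℤ → ℚ} {ωq : Fin m → ℤ → ℚ} (hω : ∀ i k, 0 < ωq i k)
    {prec p : ℕ} {Sp Sm : IntervalD} {rec : ℕ → StepRec} {box : ℕ → BoxRec} {j : ℕ} {bD : Dyad}
    (hAA' : (rec j).A ≤ (rec j).A')
    (h13 : checkBoxCovers m Kb Ka shifts (coefBoxOf prec αq ωq Sp Sm) (rec j).x (box j).lo (box j).hi (dyadToRat bD)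
      (dyadToRat (rec j).mC) (dyadToRat (rec j).ρC) (rec j).E₀ (rec j).h (rec j).A' = true)
    {y : Fin m → ℤ → ℝ} (hy : hullOfB Kb Ka shifts q αq ωq prec p Sp Sm bD rec j y) :
    InBoxOn Kb Ka (wbox Kb Ka (fun i k => (ωq i k : ℝ)) (box j).lo) (wbox Kb Ka (fun i k => (ωq i k : ℝ)) (box j).hi) y := by
  obtain ⟨u, hu, q', -, hpic, hnear⟩ := hy
  have key := inBox_of_checkBoxCovers (Kb := Kb) (Ka := Ka) hnd hω h13 (u := u) (q := q') (y := y) hu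
  simp only [cast_dyadToRat] at key
  have hAA'r : ((rec j).A : ℝ) ≤ ((rec j).A' : ℝ) := by exact_mod_cast hAA'
  exact key hpic fun i k hk1 hk2 => (hnear i k hk1 hk2).trans
    (mul_le_mul_of_nonneg_right hAA'r (by exact_mod_cast (hω i k).le))

/-- **Box consequence, weighted form**: on the window, a hull state satisfies `ω·lo_c ≤ y i k ≤ ω·hi_c`, `c = idx(i,k)`. [folklore] -/
theorem hull_coord_bounds {shifts : List (ℤ × ℤ × ℤ)} (hnd : shifts.Nodup) {q : ℚ}
    {αq : Fin m → Fin m → Fin m → ℤ × ℤ × ℤ → ℚ} {ωq : Fin m → ℤ → ℚ} (hω : ∀ i k, 0 < ωq i k)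
    {prec p : ℕ} {Sp Sm : IntervalD} {rec : ℕ → StepRec} {box : ℕ → BoxRec} {j : ℕ} {bD : Dyad}
    (hAA' : (rec j).A ≤ (rec j).A')
    (h13 : checkBoxCovers m Kb Ka shifts (coefBoxOf prec αq ωq Sp Sm) (rec j).x (box j).lo (box j).hi (dyadToRat bD)
      (dyadToRat (rec j).mC) (dyadToRat (rec j).ρC) (rec j).E₀ (rec j).h (rec j).A' = true)
    {y : Fin m → ℤ → ℝ} (hy : hullOfB Kb Ka shifts q αq ωq prec p Sp Sm bD rec j y) (i : Fin m) {k : ℤ}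
    (hk : -Kb ≤ k ∧ k ≤ Ka) :
    (ωq i k : ℝ) * (dgetD (box j).lo (idxOf Kb Ka i k hk)).toReal ≤ y i k ∧
      y i k ≤ (ωq i k : ℝ) * (dgetD (box j).hi (idxOf Kb Ka i k hk)).toReal := by
  have h := inBox_of_hullOfB hnd hω hAA' h13 hy i k hk.1 hk.2
  simp only [wbox, dif_pos hk] at h
  exact h

end CertificateGlueOn

end Summit.NavierStokesRegularity.NavierStokesRegularity.Theorems
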